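import Summits.AtomisticToContinuum.HydrodynamicLimit.Theorems.CollisionIsometryCLTMacroClosureEngineBlockClosureB
import Literature.MathematicalPhysics.KineticTheory.HardSphereEulerPrimitiveForm
import HarnessLib

/-!
# Sub-goal `engine_blockClosure` of the lead's stub `stub_engine_pointwise` (line `IdeatorTwoGen1Sketch`, crux
# `MacroClosure`, stmt-AtomisticToContinuum-14870): closing the block production with CTL + FMR

For a classical hs-Euler solution `(ρ, u, θ)` on `[0, T)` in the dilute chamber of `ThermoChamber η₃`,
`0 < t < T` and a band floor `c₁ > 0`, there is `C ≥ 0` such that for every smooth kernel `φ ≥ 0` of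
unit mass supported in `{euclidDist(·, 0) < r}`, every configuration `w` whose blocks lie in the band
`c₁ ≤ ρ̄ ≤ σ⁻³`, and every `s ∈ (0, t)`,

`|kinFlux(s,w) + ∫ₓ ccClosure(s,w,x) dx − prodBlock(s,w)| ≤
C r ⟨emp w, 1 + |v|³⟩ + C (∫ₓ Σ D² + |q|²)^{1/2} (1 + ⟨emp w, |v|²⟩)^{1/2}`.

Proof (with the helpers A — commutators and block algebra — and B — block analysis on the band).
1. `lam_smooth`, `Lcl_derivs`: by clause 3 of `ThermoChamber`, `Λ = Dη_σ(U_cl)` has the explicit form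
   `Λ V = λ⁰ V.ρ + Σₖ λᵐₖ V.mₖ + λᴱ V.E` with `λ⁰ = lam0`, `λᵐ = lamM`, `λᴱ = lamE` jointly smooth on
   `[0, T) × 𝕋³`, hence `∂ₛΛ V = ∂ₛλ⁰ V.ρ + Σₖ ∂ₛλᵐₖ V.mₖ + ∂ₛλᴱ V.E` (one-sided within `[0, T)`) and
   `∂ⱼΛ V = ∂ⱼλ⁰ V.ρ + Σₖ ∂ⱼλᵐₖ V.mₖ + ∂ⱼλᴱ V.E` (uniqueness of derivatives). The twenty derivative
   fields `∂ₛλ⁰, ∂ⱼλ⁰, ∂ₛλᵐₖ, ∂ₛλᴱ, ∂ⱼλᵐₖ, ∂ⱼλᴱ` and their Lipschitz constants (minimal-image distance)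
   are bounded by one `L` on `[0, t] × 𝕋³` (`weights_bounds`); at interior times the two-sided time
   derivatives of `kinFlux` are the one-sided ones (`kinFlux_eq`), so `kinFlux = ⟨emp w, W(s,·,·)⟩`
   with the kinetic weight `W`.
2. Mollifier commutator (B4, per particle, Lipschitz form): `|⟨emp, W⟩ − ∫ₓ ⟨emp, φ(·−x) W(x,·)⟩| ≤
   20 L r ⟨emp, 1 + |v|³⟩` (`commutator_velocity`, `lipschitz_kineticWeight`).
3. The block identity (`prodBlock_eq`): `prodBlock = ∫ₓ ⟨emp, φ(·−x) W(x,·)⟩ + ∫ₓ ccClosure − ∫ₓ Rem`,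
   from the exact kinetic-flux algebra (B3) — `⟨φ vⱼvₖ⟩ = ρ̄ūⱼūₖ + ρ̄θ̄δⱼₖ + Dⱼₖ`,
   `⟨φ vⱼ|v|²/2⟩ = (Ē + ρ̄θ̄)ūⱼ + Σₖ Dⱼₖūₖ + qⱼ` — in which the `ρ̄θ̄` of (B3) and the `p̄ − ρ̄θ̄` of the
   collisional closure combine into the pressure `p̄` of the hs-Euler fluxes `Fⱼ(Ū)` (pointwise in
   `x`, `pointwise_identity`), leaving the kinetic remainder
   `Rem = Σⱼₖ ∂ⱼλᵐₖ Dⱼₖ + Σⱼ ∂ⱼλᴱ (Σₖ Dⱼₖūₖ + qⱼ)`; the three densities are integrable in `x`, the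
   pressure terms on the band by Ruelle convexity (`HsFreeEnergyConvex`).
4. `|∫ₓ Rem| ≤ 12 L √(2(1 + c₁⁻¹)) (∫ₓ Σ D² + |q|²)^{1/2} (1 + ⟨emp, |v|²⟩)^{1/2}` (Cauchy–Schwarz in the
   finite sums and in `x`, `|ū|² ≤ 2Ē/c₁`, `∫ₓ Ē = ⟨emp, |v|²/2⟩`; `integral_rem_le`).
With `C = 20 L + 12 L √(2(1 + c₁⁻¹))` the claim follows.
-/

noncomputable section

open MeasureTheory Filter Set Topology InformationTheory
open scoped ENNReal ContDiff

namespace Summit.AtomisticToContinuum.HydrodynamicLimit.Theorems.MacroClosureLine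

open Literature.MathematicalPhysics.KineticTheory Literature.Analysis.FluidPDE
open Literature.Analysis.FunctionSpaces
open Summit.AtomisticToContinuum.HydrodynamicLimit.Theses

namespace Barycentric

namespace EngineBlockClosure

section Solution

variable {σ η₃ T : ℝ} {ρ θ : ℝ → T3 → ℝ} {u : ℝ → T3 → V3}

/-- **The entropy variables** (clause 3 of `ThermoChamber`): `Λ = Lcl σ ρ θ u`, `lam0`, `lamM`, `lamE`
are jointly smooth on `[0, T) × 𝕋³` and `Λ(s,x)V = λ⁰ V.1 + Σⱼ λᵐⱼ V.2.1ⱼ + λᴱ V.2.2` there. -/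
theorem lam_smooth (hσ : 0 < σ) (hE : IsHardSphereEulerSolution σ T ρ u θ) (hT : ThermoChamber η₃)
    (hpack : ∀ s ∈ Ico 0 T, ∀ x, ρ s x * σ ^ 3 < η₃) :
    Torus.IsSmoothSpaceTimeOn (Ico 0 T) (Lcl σ ρ θ u) ∧
    Torus.IsSmoothSpaceTimeOn (Ico 0 T) (lam0 σ ρ θ u) ∧
    Torus.IsSmoothSpaceTimeOn (Ico 0 T) (lamM θ u) ∧
    Torus.IsSmoothSpaceTimeOn (Ico 0 T) (lamE θ) ∧
    ∀ s ∈ Ico 0 T, ∀ (x : T3) (V : State), Lcl σ ρ θ u s x V =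
      lam0 σ ρ θ u s x * V.1 + (∑ j, lamM θ u s x j * V.2.1 j) + lamE θ s x * V.2.2 := by
  -- as in `Barycentric.engine_obsCommutator`
  obtain ⟨hΛ, hΛeq, -, -⟩ := (hT σ hσ).2.2 T ρ θ u hE hpack
  have hinner : ∀ a b : V3, inner ℝ a b = ∑ j, a j * b j := fun a b => by
    rw [PiLp.inner_apply]
    exact Finset.sum_congr rfl fun j _ => by rw [RCLike.inner_apply, conj_trivial, mul_comm]
  have hL : ∀ s ∈ Ico 0 T, ∀ (x : T3) (V : State), Lcl σ ρ θ u s x V =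
      lam0 σ ρ θ u s x * V.1 + (∑ j, lamM θ u s x j * V.2.1 j) + lamE θ s x * V.2.2 := by
    intro s hs x V
    have h := hΛeq s hs x V
    rw [← hinner]
    simp only [Lcl, Ucl, lam0, lamM, lamE]
    rw [h]
    ring
  have h0 : Torus.IsSmoothSpaceTimeOn (Ico 0 T) (lam0 σ ρ θ u) := by
    refine (hΛ.clm_comp (ContinuousLinearMap.apply ℝ ℝ (((1 : ℝ), ((0 : V3), (0 : ℝ))) : State))).congr ?_
    rintro ⟨s, y⟩ hp
    have hs : s ∈ Ico 0 T := (mem_prod.1 hp).1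
    simp only [Torus.stLift_apply, ContinuousLinearMap.apply_apply]
    rw [hΛeq s hs]
    simp [lam0]
  have hθinv : Torus.IsSmoothSpaceTimeOn (Ico 0 T) (fun s x => (θ s x)⁻¹) :=
    ContDiffOn.inv hE.smooth_temperature fun p hp =>
      (hE.temperature_pos p.1 (mem_prod.1 hp).1 (Torus.proj p.2)).ne'
  exact ⟨hΛ, h0, hθinv.smul hE.smooth_velocity, hθinv.neg, hL⟩

/-- **Derivatives of the entropy-variable field, applied to a state**: for `s ∈ [0, T)`,
`∂ₛΛ(s,x)V = ∂ₛλ⁰ V.1 + Σₖ ∂ₛλᵐₖ V.2.1ₖ + ∂ₛλᴱ V.2.2` (one-sided within `[0, T)`) and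
`∂ⱼΛ(s,x)V = ∂ⱼλ⁰ V.1 + Σₖ ∂ⱼλᵐₖ V.2.1ₖ + ∂ⱼλᴱ V.2.2`. -/
theorem Lcl_derivs (hσ : 0 < σ) (hE : IsHardSphereEulerSolution σ T ρ u θ) (hT : ThermoChamber η₃)
    (hpack : ∀ s ∈ Ico 0 T, ∀ x, ρ s x * σ ^ 3 < η₃) {s : ℝ} (hs : s ∈ Ico 0 T) (x : T3) :
    (∀ V : State, Torus.timeDerivWithin (Ico 0 T) (Lcl σ ρ θ u) s x V =
      Torus.timeDerivWithin (Ico 0 T) (lam0 σ ρ θ u) s x * V.1 +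
        (∑ k, Torus.timeDerivWithin (Ico 0 T) (lamM θ u) s x k * V.2.1 k) +
        Torus.timeDerivWithin (Ico 0 T) (lamE θ) s x * V.2.2) ∧
    ∀ (j : Fin 3) (V : State), Torus.partialDeriv j (Lcl σ ρ θ u s) x V =
      Torus.partialDeriv j (lam0 σ ρ θ u s) x * V.1 +
        (∑ k, Torus.partialDeriv j (fun y => lamM θ u s y k) x * V.2.1 k) +
        Torus.partialDeriv j (lamE θ s) x * V.2.2 := by
  obtain ⟨hΛ, h0, hM, hEE, hL⟩ := lam_smooth hσ hE hT hpack
  have hU : UniqueDiffOn ℝ (Ico (0 : ℝ) T) := uniqueDiffOn_Ico 0 T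
  constructor
  · intro V
    have h1 : HasDerivWithinAt (fun τ => Lcl σ ρ θ u τ x V)
        (Torus.timeDerivWithin (Ico 0 T) (Lcl σ ρ θ u) s x V) (Ico 0 T) s := by
      have h := (hΛ.hasDerivWithinAt_slice hs x).clm_apply (hasDerivWithinAt_const s (Ico 0 T) V)
      simpa only [map_zero, add_zero] using h
    have hMk : ∀ k, HasDerivWithinAt (fun τ => lamM θ u τ x k)
        (Torus.timeDerivWithin (Ico 0 T) (lamM θ u) s x k) (Ico 0 T) s := fun k => by
      have h := (hM.apply k).hasDerivWithinAt_slice hs x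
      rwa [HsEulerCalc.timeDerivWithin_apply_coord hM hU hs x k] at h
    have h2 : HasDerivWithinAt (fun τ => lam0 σ ρ θ u τ x * V.1 +
        (∑ k, lamM θ u τ x k * V.2.1 k) + lamE θ τ x * V.2.2)
        (Torus.timeDerivWithin (Ico 0 T) (lam0 σ ρ θ u) s x * V.1 +
          (∑ k, Torus.timeDerivWithin (Ico 0 T) (lamM θ u) s x k * V.2.1 k) +
          Torus.timeDerivWithin (Ico 0 T) (lamE θ) s x * V.2.2) (Ico 0 T) s :=
      (((h0.hasDerivWithinAt_slice hs x).mul_const _).add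
        (HasDerivWithinAt.fun_sum fun k _ => (hMk k).mul_const _)).add
        ((hEE.hasDerivWithinAt_slice hs x).mul_const _)
    exact (hU s hs).eq_deriv _ h1 (h2.congr_of_mem (fun τ hτ => hL τ hτ x V) hs)
  · intro j V
    -- derivative along the `j`-th coordinate line (as `Barycentric.EngineClassical.hasDerivAt_coordLine`)
    have coordLine : ∀ {E' : Type} [NormedAddCommGroup E'] [NormedSpace ℝ E'] {f : T3 → E'},
        Torus.IsContDiff 1 f → HasDerivAt
          (fun τ : ℝ => f (x + Torus.proj (τ • EuclideanSpace.single j (1 : ℝ))))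
          (Torus.partialDeriv j f x) 0 := by
      intro E' _ _ f hf
      have h := Torus.hasDerivAt_comp_add_proj_smul hf x (EuclideanSpace.single j (1 : ℝ)) 0
      simp only [zero_smul, Torus.proj_zero, add_zero] at h
      exact h
    have hΛ1 : Torus.IsContDiff 1 (Lcl σ ρ θ u s) := (hΛ.isSmooth_slice hs).isContDiff (by simp)
    have h01 : Torus.IsContDiff 1 (lam0 σ ρ θ u s) := (h0.isSmooth_slice hs).isContDiff (by simp)
    have hM1 : ∀ k, Torus.IsContDiff 1 (fun y => lamM θ u s y k) := fun k =>
      ((hM.apply k).isSmooth_slice hs).isContDiff (by simp)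
    have hE1 : Torus.IsContDiff 1 (lamE θ s) := (hEE.isSmooth_slice hs).isContDiff (by simp)
    have h1 : HasDerivAt
        (fun τ : ℝ => Lcl σ ρ θ u s (x + Torus.proj (τ • EuclideanSpace.single j (1 : ℝ))) V)
        (Torus.partialDeriv j (Lcl σ ρ θ u s) x V) 0 := by
      have h := (coordLine hΛ1).clm_apply (hasDerivAt_const (0 : ℝ) V)
      simpa only [map_zero, add_zero] using h
    have h2 : HasDerivAt (fun τ : ℝ =>
        lam0 σ ρ θ u s (x + Torus.proj (τ • EuclideanSpace.single j (1 : ℝ))) * V.1 +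
        (∑ k, lamM θ u s (x + Torus.proj (τ • EuclideanSpace.single j (1 : ℝ))) k * V.2.1 k) +
        lamE θ s (x + Torus.proj (τ • EuclideanSpace.single j (1 : ℝ))) * V.2.2)
        (Torus.partialDeriv j (lam0 σ ρ θ u s) x * V.1 +
          (∑ k, Torus.partialDeriv j (fun y => lamM θ u s y k) x * V.2.1 k) +
          Torus.partialDeriv j (lamE θ s) x * V.2.2) 0 :=
      (((coordLine h01).mul_const _).add
        (HasDerivAt.fun_sum fun k _ => (coordLine (hM1 k)).mul_const _)).add
        ((coordLine hE1).mul_const _)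
    exact h1.unique (h2.congr_of_eventuallyEq (Eventually.of_forall fun τ => hL s hs _ V))

/-- **`kinFlux` at interior times**: the two-sided time derivatives of the entropy variables are the
one-sided ones within `[0, T)`. -/
theorem kinFlux_eq {s : ℝ} (hs : s ∈ Ioo 0 T) {n : ℕ} (w : Config (n + 1) (Fin 3) T3) :
    kinFlux σ ρ θ u s w = ∫ y, (Torus.timeDerivWithin (Ico 0 T) (lam0 σ ρ θ u) s y.1 +
      (∑ j, y.2 j * Torus.partialDeriv j (lam0 σ ρ θ u s) y.1) +
      (∑ j, Torus.timeDerivWithin (Ico 0 T) (lamM θ u) s y.1 j * y.2 j) +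
      Torus.timeDerivWithin (Ico 0 T) (lamE θ) s y.1 * (‖y.2‖ ^ 2 / 2) +
      (∑ j, ∑ k, Torus.partialDeriv j (fun x => lamM θ u s x k) y.1 * (y.2 j * y.2 k)) +
      ∑ j, Torus.partialDeriv j (lamE θ s) y.1 * (y.2 j * (‖y.2‖ ^ 2 / 2))) ∂(empiricalMeasure w) := by
  have hsI : s ∈ interior (Ico (0 : ℝ) T) := by rw [interior_Ico]; exact hs
  simp only [kinFlux, ← Torus.timeDerivWithin_of_mem_interior hsI]

/-- **One constant for the twenty derivative fields** `∂ₛλ⁰, ∂ₛλᴱ, ∂ⱼλ⁰, ∂ₛλᵐⱼ, ∂ⱼλᴱ, ∂ⱼλᵐₖ`: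
sup bounds and Lipschitz bounds (minimal-image distance) on `[0, t] × 𝕋³`, `t < T`. -/
theorem weights_bounds (hσ : 0 < σ) (hE : IsHardSphereEulerSolution σ T ρ u θ) (hT : ThermoChamber η₃)
    (hpack : ∀ s ∈ Ico 0 T, ∀ x, ρ s x * σ ^ 3 < η₃) {t : ℝ} (htT : t < T) :
    ∃ L : ℝ, 0 ≤ L ∧ ∀ s ∈ Icc (0 : ℝ) t,
      ((∀ x, |Torus.timeDerivWithin (Ico 0 T) (lam0 σ ρ θ u) s x| ≤ L) ∧
        ∀ x y, |Torus.timeDerivWithin (Ico 0 T) (lam0 σ ρ θ u) s x -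
          Torus.timeDerivWithin (Ico 0 T) (lam0 σ ρ θ u) s y| ≤ L * Torus.euclidDist x y) ∧
      ((∀ x, |Torus.timeDerivWithin (Ico 0 T) (lamE θ) s x| ≤ L) ∧
        ∀ x y, |Torus.timeDerivWithin (Ico 0 T) (lamE θ) s x -
          Torus.timeDerivWithin (Ico 0 T) (lamE θ) s y| ≤ L * Torus.euclidDist x y) ∧
      (∀ j, (∀ x, |Torus.partialDeriv j (lam0 σ ρ θ u s) x| ≤ L) ∧
        ∀ x y, |Torus.partialDeriv j (lam0 σ ρ θ u s) x - Torus.partialDeriv j (lam0 σ ρ θ u s) y| ≤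
          L * Torus.euclidDist x y) ∧
      (∀ j, (∀ x, |Torus.timeDerivWithin (Ico 0 T) (lamM θ u) s x j| ≤ L) ∧
        ∀ x y, |Torus.timeDerivWithin (Ico 0 T) (lamM θ u) s x j -
          Torus.timeDerivWithin (Ico 0 T) (lamM θ u) s y j| ≤ L * Torus.euclidDist x y) ∧
      (∀ j, (∀ x, |Torus.partialDeriv j (lamE θ s) x| ≤ L) ∧
        ∀ x y, |Torus.partialDeriv j (lamE θ s) x - Torus.partialDeriv j (lamE θ s) y| ≤
          L * Torus.euclidDist x y) ∧
      ∀ j k, (∀ x, |Torus.partialDeriv j (fun y => lamM θ u s y k) x| ≤ L) ∧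
        ∀ x y, |Torus.partialDeriv j (fun y => lamM θ u s y k) x -
          Torus.partialDeriv j (fun y => lamM θ u s y k) y| ≤ L * Torus.euclidDist x y := by
  obtain ⟨-, h0, hM, hEE, -⟩ := lam_smooth hσ hE hT hpack
  have hU : UniqueDiffOn ℝ (Ico (0 : ℝ) T) := uniqueDiffOn_Ico 0 T
  obtain ⟨L₁, hL₁, h₁⟩ := family_bounds htT
    (fun _ _ => Torus.timeDerivWithin (Ico 0 T) (lam0 σ ρ θ u)) fun _ _ => h0.timeDerivWithin hU
  obtain ⟨L₂, hL₂, h₂⟩ := family_bounds htT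
    (fun _ _ => Torus.timeDerivWithin (Ico 0 T) (lamE θ)) fun _ _ => hEE.timeDerivWithin hU
  obtain ⟨L₃, hL₃, h₃⟩ := family_bounds htT
    (fun j _ s => Torus.partialDeriv j (lam0 σ ρ θ u s)) fun j _ => h0.partialDeriv hU j
  obtain ⟨L₄, hL₄, h₄⟩ := family_bounds htT
    (fun j _ s x => Torus.timeDerivWithin (Ico 0 T) (lamM θ u) s x j)
    fun j _ => (hM.timeDerivWithin hU).apply j
  obtain ⟨L₅, hL₅, h₅⟩ := family_bounds htT
    (fun j _ s => Torus.partialDeriv j (lamE θ s)) fun j _ => hEE.partialDeriv hU j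
  obtain ⟨L₆, hL₆, h₆⟩ := family_bounds htT
    (fun j k s => Torus.partialDeriv j (fun y => lamM θ u s y k)) fun j k => (hM.apply k).partialDeriv hU j
  refine ⟨L₁ + L₂ + L₃ + L₄ + L₅ + L₆, by positivity, fun s hs => ⟨?_, ?_, ?_, ?_, ?_, ?_⟩⟩
  · exact h₁ _ (by linarith) 0 0 s hs
  · exact h₂ _ (by linarith) 0 0 s hs
  · exact fun j => h₃ _ (by linarith) j 0 s hs
  · exact fun j => h₄ _ (by linarith) j 0 s hs
  · exact fun j => h₅ _ (by linarith) j 0 s hs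
  · exact fun j k => h₆ _ (by linarith) j k s hs

/-- The twenty derivative fields have continuous time slices on `[0, T)`. -/
theorem weights_continuous (hσ : 0 < σ) (hE : IsHardSphereEulerSolution σ T ρ u θ)
    (hT : ThermoChamber η₃) (hpack : ∀ s ∈ Ico 0 T, ∀ x, ρ s x * σ ^ 3 < η₃) {s : ℝ}
    (hs : s ∈ Ico 0 T) :
    Continuous (fun x => Torus.timeDerivWithin (Ico 0 T) (lam0 σ ρ θ u) s x) ∧
    Continuous (fun x => Torus.timeDerivWithin (Ico 0 T) (lamE θ) s x) ∧
    (∀ j, Continuous fun x => Torus.partialDeriv j (lam0 σ ρ θ u s) x) ∧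
    (∀ j, Continuous fun x => Torus.timeDerivWithin (Ico 0 T) (lamM θ u) s x j) ∧
    (∀ j, Continuous fun x => Torus.partialDeriv j (lamE θ s) x) ∧
    ∀ j k, Continuous fun x => Torus.partialDeriv j (fun y => lamM θ u s y k) x := by
  obtain ⟨-, h0, hM, hEE, -⟩ := lam_smooth hσ hE hT hpack
  have hU : UniqueDiffOn ℝ (Ico (0 : ℝ) T) := uniqueDiffOn_Ico 0 T
  exact ⟨((h0.timeDerivWithin hU).isSmooth_slice hs).continuous,
    ((hEE.timeDerivWithin hU).isSmooth_slice hs).continuous,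
    fun j => ((h0.partialDeriv hU j).isSmooth_slice hs).continuous,
    fun j => (((hM.timeDerivWithin hU).apply j).isSmooth_slice hs).continuous,
    fun j => ((hEE.partialDeriv hU j).isSmooth_slice hs).continuous,
    fun j k => (((hM.apply k).partialDeriv hU j).isSmooth_slice hs).continuous⟩

/-- **The block identity.** On a band configuration (`c₁ ≤ ρ̄ ≤ σ⁻³` on every block) and for
`s ∈ [0, T)`: `prodBlock = ∫ₓ ⟨emp w, φ(· − x) W(s,x,·)⟩ + ∫ₓ ccClosure − ∫ₓ Rem`, with the kinetic
weight `W` of `kinFlux` (one-sided time derivatives) and the kinetic remainder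
`Rem = Σⱼₖ ∂ⱼλᵐₖ Dⱼₖ + Σⱼ ∂ⱼλᴱ (Σₖ Dⱼₖ ūₖ + qⱼ)`. The three densities are integrable (the pressure terms
by `HsFreeEnergyConvex` on the band) and the identity holds pointwise in `x` (`pointwise_identity`,
the block pressure cancelling exactly). -/
theorem prodBlock_eq (hH : StiffCollisionalRelaxation.HsFreeEnergyConvex) (hσ : 0 < σ)
    (hE : IsHardSphereEulerSolution σ T ρ u θ) (hT : ThermoChamber η₃)
    (hpack : ∀ s ∈ Ico 0 T, ∀ x, ρ s x * σ ^ 3 < η₃) {s : ℝ} (hs : s ∈ Ico 0 T) {c₁ : ℝ}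
    (hc₁ : 0 < c₁) {n : ℕ} {φ : T3 → ℝ} (hφ : Torus.IsSmooth φ) (hφ0 : ∀ y, 0 ≤ φ y)
    (w : Config (n + 1) (Fin 3) T3) (hband : ∀ x, c₁ ≤ bρ φ w x ∧ bρ φ w x * σ ^ 3 ≤ 1) :
    prodBlock σ T ρ θ u φ s w =
      (∫ x, ∫ y, φ (y.1 - x) * (Torus.timeDerivWithin (Ico 0 T) (lam0 σ ρ θ u) s x +
          (∑ j, y.2 j * Torus.partialDeriv j (lam0 σ ρ θ u s) x) +
          (∑ j, Torus.timeDerivWithin (Ico 0 T) (lamM θ u) s x j * y.2 j) +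
          Torus.timeDerivWithin (Ico 0 T) (lamE θ) s x * (‖y.2‖ ^ 2 / 2) +
          (∑ j, ∑ k, Torus.partialDeriv j (fun y => lamM θ u s y k) x * (y.2 j * y.2 k)) +
          ∑ j, Torus.partialDeriv j (lamE θ s) x * (y.2 j * (‖y.2‖ ^ 2 / 2))) ∂(empiricalMeasure w)) +
      (∫ x, ccClosure σ θ u φ s w x) -
      ∫ x, ((∑ j, ∑ k, Torus.partialDeriv j (fun y => lamM θ u s y k) x * bD φ w x j k) +
        ∑ j, Torus.partialDeriv j (lamE θ s) x * ((∑ k, bD φ w x j k * bu φ w x k) + bq φ w x j)) := by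
  obtain ⟨hΛ, h0, hM, hEE, hL⟩ := lam_smooth hσ hE hT hpack
  have hU : UniqueDiffOn ℝ (Ico (0 : ℝ) T) := uniqueDiffOn_Ico 0 T
  have hφc : Continuous φ := hφ.continuous
  have hρ : ∀ x, bρ φ w x ≠ 0 := fun x => (hc₁.trans_le (hband x).1).ne'
  obtain ⟨-, huj, -, -, hD, -, hqj⟩ := continuous_blocks hφc w hρ
  obtain ⟨c1, c4, c2, c3, c6, c5⟩ := weights_continuous hσ hE hT hpack hs
  have hE1 : Torus.IsContDiff 1 (lamE θ s) := (hEE.isSmooth_slice hs).isContDiff (by simp)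
  -- integrability of the three densities
  have iG := integrable_smoothedWeight hφc _ (continuous_kineticWeight c1 c4 c2 c3 c6 c5) w
  have hpref : Continuous fun x => Torus.divergence (lamM θ u s) x +
      ∑ j, Torus.gradient (lamE θ s) x j * bu φ w x j :=
    (hM.isSmooth_slice hs).divergence.continuous.add (continuous_finsetSum _ fun j _ =>
      ((EuclideanSpace.proj j : V3 →L[ℝ] ℝ).continuous.comp
        (hEE.isSmooth_slice hs).gradient.continuous).mul (huj j))
  have icc : Integrable (fun x => ccClosure σ θ u φ s w x) :=
    integrable_closure hH hσ hc₁ hφc w hband hpref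
  have iR : Integrable (fun x =>
      (∑ j, ∑ k, Torus.partialDeriv j (fun y => lamM θ u s y k) x * bD φ w x j k) +
        ∑ j, Torus.partialDeriv j (lamE θ s) x * ((∑ k, bD φ w x j k * bu φ w x k) + bq φ w x j)) :=
    integrable_of_continuous_T3 ((continuous_finsetSum _ fun j _ => continuous_finsetSum _ fun k _ =>
      (c5 j k).mul (hD j k)).add (continuous_finsetSum _ fun j _ => (c6 j).mul
        ((continuous_finsetSum _ fun k _ => (hD j k).mul (huj k)).add (hqj j))))
  -- the pointwise identity
  have hG := fun x => smoothed_weight_block hφ0 w x (Torus.timeDerivWithin (Ico 0 T) (lam0 σ ρ θ u) s)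
    (Torus.timeDerivWithin (Ico 0 T) (lamE θ) s) (fun j => Torus.partialDeriv j (lam0 σ ρ θ u s))
    (fun j x => Torus.timeDerivWithin (Ico 0 T) (lamM θ u) s x j)
    (fun j => Torus.partialDeriv j (lamE θ s)) (fun j k => Torus.partialDeriv j (fun y => lamM θ u s y k))
  have hcc : ∀ x, ccClosure σ θ u φ s w x =
      ((∑ j, Torus.partialDeriv j (fun y => lamM θ u s y j) x) +
        ∑ j, Torus.partialDeriv j (lamE θ s) x * bu φ w x j) *
        (hsPressure σ (bρ φ w x) (bθ φ w x) - bρ φ w x * bθ φ w x) := fun x => by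
    simp only [ccClosure, Torus.divergence, HsEulerCalc.gradient_apply_eq_partialDeriv hE1]
  have hD1 : ∀ x, Torus.timeDerivWithin (Ico 0 T) (Lcl σ ρ θ u) s x (bU φ w x) =
      Torus.timeDerivWithin (Ico 0 T) (lam0 σ ρ θ u) s x * bρ φ w x +
        (∑ k, Torus.timeDerivWithin (Ico 0 T) (lamM θ u) s x k * bm φ w x k) +
        Torus.timeDerivWithin (Ico 0 T) (lamE θ) s x * bE φ w x := fun x =>
    (Lcl_derivs hσ hE hT hpack hs x).1 (bU φ w x)
  have hpt := fun x => pointwise_identity σ φ w x (hρ x)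
    (Torus.timeDerivWithin (Ico 0 T) (lam0 σ ρ θ u) s x) (Torus.timeDerivWithin (Ico 0 T) (lamE θ) s x)
    (fun j => Torus.partialDeriv j (lam0 σ ρ θ u s) x)
    (fun j => Torus.timeDerivWithin (Ico 0 T) (lamM θ u) s x j)
    (fun j => Torus.partialDeriv j (lamE θ s) x) (fun j k => Torus.partialDeriv j (fun y => lamM θ u s y k) x)
  beta_reduce at hG hpt
  unfold prodBlock
  rw [← integral_add iG icc, ← integral_sub _ iR]
  · refine integral_congr_ae (Eventually.of_forall fun x => ?_)
    beta_reduce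
    rw [hD1 x, hG x, hcc x]
    simp only [(Lcl_derivs hσ hE hT hpack hs x).2]
    exact hpt x
  · exact iG.add icc

end Solution

/-- The final arithmetic: the commutator bound and the remainder bound add up to the claimed bound with
`C = 20 L + 12 L a`. -/
theorem final_bound {L a r M R Q X Y : ℝ} (hL : 0 ≤ L) (ha : 0 ≤ a) (hr : 0 ≤ r) (hM : 0 ≤ M)
    (hR : 0 ≤ R) (hQ : 0 ≤ Q) (hX : |X| ≤ r * (20 * L) * M) (hY : |Y| ≤ 12 * L * a * R * Q) :
    |X + Y| ≤ (20 * L + 12 * L * a) * r * M + (20 * L + 12 * L * a) * R * Q := by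
  have h1 : 0 ≤ 12 * L * a * r * M := by positivity
  have h2 : 0 ≤ 20 * L * R * Q := by positivity
  calc |X + Y| ≤ |X| + |Y| := abs_add_le X Y
    _ ≤ r * (20 * L) * M + 12 * L * a * R * Q := add_le_add hX hY
    _ ≤ _ := by nlinarith [h1, h2]

end EngineBlockClosure

/-! ## The sub-goal -/

/-- **`engine_blockClosure` (registered sub-goal of `stub_engine_pointwise`): closing the block production with
CTL + FMR.** Configuration by configuration on the band `c₁ ≤ ρ̄ ≤ σ⁻³`, the microscopic production
`kinFlux(s,w) + ∫ₓ ccClosure(s,w,x) dx` equals the block production `prodBlock(s,w)` up to mollifier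
commutators `C r ⟨emp w, 1 + |v|³⟩` and the kinetic closure defects
`C (∫ₓ Σ D² + |q|²)^{1/2} (1 + ⟨emp w, |v|²⟩)^{1/2}`, uniformly in `s ∈ (0, t)`, in the configuration
and in the kernel. -/
theorem engine_blockClosure : ∀ (σ : ℝ), 0 < σ → StiffCollisionalRelaxation.HsFreeEnergyConvex → ∀ (T : ℝ) (ρ θ : ℝ → T3 → ℝ) (u : ℝ → T3 → V3), IsHardSphereEulerSolution σ T ρ u θ → ∀ η₃ : ℝ, ThermoChamber η₃ → (∀ s ∈ Ico 0 T, ∀ x, ρ s x * σ ^ 3 < η₃) → ∀ t : ℝ, 0 < t → t < T → ∀ c₁ : ℝ, 0 < c₁ → ∃ C : ℝ, 0 ≤ C ∧ ∀ (n : ℕ) (φ : T3 → ℝ) (r : ℝ), Torus.IsSmooth φ → (∀ y, 0 ≤ φ y) → ∫ y, φ y = 1 → (∀ y, r ≤ Torus.euclidDist y 0 → φ y = 0) → ∀ w : Config (n + 1) (Fin 3) T3, (∀ x, c₁ ≤ bρ φ w x ∧ bρ φ w x * σ ^ 3 ≤ 1) → ∀ s ∈ Ioo 0 t, |kinFlux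 σ ρ θ u s w + (∫ x, ccClosure σ θ u φ s w x) - prodBlock σ T ρ θ u φ s w| ≤ C * r * (∫ y, (1 + ‖y.2‖ ^ 3) ∂(empiricalMeasure w)) + C * Real.sqrt (∫ x, ((∑ j, ∑ k, bD φ w x j k ^ 2) + ‖bq φ w x‖ ^ 2)) * Real.sqrt (1 + ∫ y, ‖y.2‖ ^ 2 ∂(empiricalMeasure w)) := by
  intro σ hσ hH T ρ θ u hE η₃ hT hpack t _ht htT c₁ hc₁
  obtain ⟨L, hL0, hB⟩ := EngineBlockClosure.weights_bounds hσ hE hT hpack htT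
  refine ⟨20 * L + 12 * L * Real.sqrt (2 * (1 + c₁⁻¹)), by positivity, ?_⟩
  intro n φ r hφ hφ0 hφ1 hsupp w hband s hs
  have hsT : s ∈ Ico 0 T := ⟨hs.1.le, hs.2.trans htT⟩
  have hsI : s ∈ Ioo 0 T := ⟨hs.1, hs.2.trans htT⟩
  have hst : s ∈ Icc 0 t := ⟨hs.1.le, hs.2.le⟩
  have hφc : Continuous φ := hφ.continuous
  have hr : 0 < r := ObsCommutator.radius_pos hφ1 hsupp
  have hband1 : ∀ x, c₁ ≤ bρ φ w x := fun x => (hband x).1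
  obtain ⟨⟨-, l₁⟩, ⟨-, l₄⟩, h₂, h₃, h₆, h₅⟩ := hB s hst
  obtain ⟨c1, c4, c2, c3, c6, c5⟩ := EngineBlockClosure.weights_continuous hσ hE hT hpack hsT
  -- (1) the commutator
  have hcomm := EngineBlockClosure.commutator_velocity hφ0 hφc hφ1 hsupp
    (fun x v => Torus.timeDerivWithin (Ico 0 T) (lam0 σ ρ θ u) s x +
      (∑ j, v j * Torus.partialDeriv j (lam0 σ ρ θ u s) x) +
      (∑ j, Torus.timeDerivWithin (Ico 0 T) (lamM θ u) s x j * v j) +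
      Torus.timeDerivWithin (Ico 0 T) (lamE θ) s x * (‖v‖ ^ 2 / 2) +
      (∑ j, ∑ k, Torus.partialDeriv j (fun y => lamM θ u s y k) x * (v j * v k)) +
      ∑ j, Torus.partialDeriv j (lamE θ s) x * (v j * (‖v‖ ^ 2 / 2)))
    (EngineBlockClosure.continuous_kineticWeight c1 c4 c2 c3 c6 c5) (by positivity : (0 : ℝ) ≤ 20 * L)
    (fun x y v => EngineBlockClosure.lipschitz_kineticWeight hL0
      (Torus.timeDerivWithin (Ico 0 T) (lam0 σ ρ θ u) s) (Torus.timeDerivWithin (Ico 0 T) (lamE θ) s)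
      (fun j => Torus.partialDeriv j (lam0 σ ρ θ u s))
      (fun j x => Torus.timeDerivWithin (Ico 0 T) (lamM θ u) s x j)
      (fun j => Torus.partialDeriv j (lamE θ s)) (fun j k => Torus.partialDeriv j (fun y => lamM θ u s y k))
      l₁ l₄ (fun j => (h₂ j).2) (fun j => (h₃ j).2) (fun j => (h₆ j).2) (fun j k => (h₅ j k).2) x y v) w
  -- (2) the remainder
  have hrem := EngineBlockClosure.integral_rem_le hφc hφ0 hφ1 w hc₁ hL0 hband1
    (fun j k x => Torus.partialDeriv j (fun y => lamM θ u s y k) x) (fun j x => Torus.partialDeriv j (lamE θ s) x)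
    (fun j k x => (h₅ j k).1 x) (fun j x => (h₆ j).1 x)
  beta_reduce at hcomm hrem
  -- (3) the block identity and the assembly
  rw [EngineBlockClosure.kinFlux_eq hsI w, EngineBlockClosure.prodBlock_eq hH hσ hE hT hpack hsT hc₁ hφ hφ0 w hband,
    show ∀ a b c d : ℝ, a + b - (c + b - d) = (a - c) + d from fun a b c d => by ring]
  exact EngineBlockClosure.final_bound hL0 (Real.sqrt_nonneg _) hr.le
    (integral_nonneg fun y => by positivity) (Real.sqrt_nonneg _) (Real.sqrt_nonneg _) hcomm hrem

end Barycentric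

end Summit.AtomisticToContinuum.HydrodynamicLimit.Theorems.MacroClosureLine

end
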